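import Mathlib
import HarnessLib

/-!
# Stub `stub_diagonalBit` — a diagonal bit sequence against countably many schedules and bit rows
# (crux `WbwObfuscatedGluedTrees`, stmt-QuantumAdvantage-2340; line `knowledge-of-walk-split`, stage 4, lead c3)

Registered stub of the stage-4 skeleton `Cruxes/WbwObfuscatedGluedTrees/Lines/knowledge_of_walk_split.lean`
(target `…Generator.Residual.ResidualAudit`).  Pure combinatorics, no project dependency: given schedules
`ms : ℕ → ℕ → ℕ` and bit rows `gs : ℕ → ℕ → Bool`, there is ONE bit sequence `b : ℕ → Bool` such that for
every row `ms i` that is unbounded along arbitrarily late indices and every bit row `gs j`, the composite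
`n ↦ b (ms i n)` differs from `gs j` at arbitrarily late `n`.

Construction (diagonal coin budget).  Stage `s` serves the pair `(ι s, κ s)` decoded from `s` by `Nat.unpair`
twice, so every pair is served at stages `≥ k` for every `k`.  A running record `V` is built by recursion:
at stage `s` an index `ν s > s` with `ms (ι s) (ν s) > V s` is chosen and `V (s + 1) := ms (ι s) (ν s)`.
Hence `V` is strictly increasing, so the value `V (s + 1)` determines its stage `s`, and
`b (V (s + 1)) := ! gs (κ s) (ν s)` is well defined and disagrees with `gs (κ s)` at `ν s`.  Rows that are
not unbounded are first replaced by the identity schedule (which is unbounded), so the recursion needs no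
case split; the replacement does not affect the conclusion, which only speaks about unbounded rows.
-/

set_option linter.dupNamespace false

namespace Summit.QuantumAdvantage.QuantumAdvantage.Theorems.WbwObfuscatedGluedTrees.KnowledgeOfWalk.Residual

/-- Core diagonal construction when EVERY row of `ms` is unbounded along arbitrarily late indices: one bit
sequence `b` such that `n ↦ b (ms i n)` differs from every `gs j` beyond every `k`. [folklore] -/
private theorem diagonalBit_of_unbounded (ms : ℕ → ℕ → ℕ) (gs : ℕ → ℕ → Bool)
    (h : ∀ i B k : ℕ, ∃ n, k < n ∧ B < ms i n) :
    ∃ b : ℕ → Bool, ∀ i j k : ℕ, ∃ n, k < n ∧ b (ms i n) ≠ gs j n := by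
  choose f hf hfB using h
  -- stage decoders: stage `Nat.pair (Nat.pair i j) t` serves the pair `(i, j)`
  obtain ⟨ι, κ, hι, hκ⟩ : ∃ ι κ : ℕ → ℕ, (∀ i j t : ℕ, ι (Nat.pair (Nat.pair i j) t) = i) ∧
      ∀ i j t : ℕ, κ (Nat.pair (Nat.pair i j) t) = j :=
    ⟨fun s => (Nat.unpair (Nat.unpair s).1).1, fun s => (Nat.unpair (Nat.unpair s).1).2,
      fun i j t => by simp [Nat.unpair_pair], fun i j t => by simp [Nat.unpair_pair]⟩
  -- the running record: `V (s + 1)` is the value of `ms` used at stage `s`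
  obtain ⟨V, hV⟩ : ∃ V : ℕ → ℕ, ∀ s, V (s + 1) = ms (ι s) (f (ι s) (V s) s) :=
    ⟨fun s => Nat.rec (motive := fun _ => ℕ) 0 (fun t w => ms (ι t) (f (ι t) w t)) s, fun _ => rfl⟩
  -- the index chosen at stage `s`
  obtain ⟨ν, hν, hνB, hνV⟩ : ∃ ν : ℕ → ℕ, (∀ s, s < ν s) ∧ (∀ s, V s < ms (ι s) (ν s)) ∧
      ∀ s, V (s + 1) = ms (ι s) (ν s) :=
    ⟨fun s => f (ι s) (V s) s, fun s => hf _ _ _, fun s => hfB _ _ _, hV⟩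
  have hstep : ∀ s, V s < V (s + 1) := fun s => (hνB s).trans_eq (hνV s).symm
  have hinv : ∀ s, Function.invFun V (V s) = s :=
    Function.leftInverse_invFun (strictMono_nat_of_lt_succ hstep).injective
  -- the diagonal bit: at the value used at stage `s`, negate the bit row `κ s` at the index `ν s`
  obtain ⟨b, hb⟩ : ∃ b : ℕ → Bool, ∀ s, b (V (s + 1)) = !gs (κ s) (ν s) :=
    ⟨fun v => !gs (κ (Function.invFun V v - 1)) (ν (Function.invFun V v - 1)),
      fun s => by simp only [hinv, Nat.add_sub_cancel]⟩
  have hstage : ∀ s, b (ms (ι s) (ν s)) ≠ gs (κ s) (ν s) := fun s => by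
    rw [← hνV, hb]
    exact Bool.not_ne_self _
  refine ⟨b, fun i j k => ⟨ν (Nat.pair (Nat.pair i j) k), (Nat.right_le_pair _ _).trans_lt (hν _), ?_⟩⟩
  have hs := hstage (Nat.pair (Nat.pair i j) k)
  rwa [hι, hκ] at hs

/-- **Stub `stub_diagonalBit`** (diagonal coin budget): for schedules `ms : ℕ → ℕ → ℕ` and bit rows
`gs : ℕ → ℕ → Bool` there is one bit sequence `b` such that, for every row `ms i` unbounded along arbitrarily
late indices and every `j`, the composite `n ↦ b (ms i n)` differs from `gs j` at arbitrarily late `n`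
(so it is not eventually equal to any of the rows `gs j`). [folklore] -/
theorem stub_diagonalBit :
    ∀ (ms : ℕ → ℕ → ℕ) (gs : ℕ → ℕ → Bool), ∃ b : ℕ → Bool,
      ∀ i, (∀ B k : ℕ, ∃ n, k < n ∧ B < ms i n) → ∀ j k : ℕ, ∃ n, k < n ∧ b (ms i n) ≠ gs j n := by
  intro ms gs
  -- replace every row that is not unbounded by the identity schedule, which is unbounded
  have hid : ∀ B k : ℕ, ∃ n, k < n ∧ B < n := fun B k => ⟨B + k + 1, by omega, by omega⟩
  have hrow : ∀ i, ∃ m : ℕ → ℕ, (∀ B k : ℕ, ∃ n, k < n ∧ B < m n) ∧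
      ((∀ B k : ℕ, ∃ n, k < n ∧ B < ms i n) → m = ms i) := by
    intro i
    by_cases hi : ∀ B k : ℕ, ∃ n, k < n ∧ B < ms i n
    · exact ⟨ms i, hi, fun _ => rfl⟩
    · exact ⟨fun n => n, hid, fun h => absurd h hi⟩
  choose ms' hms' hms'eq using hrow
  obtain ⟨b, hb⟩ := diagonalBit_of_unbounded ms' gs hms'
  refine ⟨b, fun i hi j k => ?_⟩
  rw [← hms'eq i hi]
  exact hb i j k

end Summit.QuantumAdvantage.QuantumAdvantage.Theorems.WbwObfuscatedGluedTrees.KnowledgeOfWalk.Residual
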